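import Mathlib
import HarnessLib.Audit.Tags

/-!
# The instrument's per-member norm as a closed-form determinant (`norm_cubic`, `reduce_mod_S`; bus R329)

Honest framing: a Lean typing task in elementary commutative algebra (a 3×3 determinant identity), PROVED;
0 kit core-h, no job, no census, no instrument run, no curve, no Galois-image determination, no modularity claim;
it says nothing about any census member.  Mathlib-only (checkable independently of the cell's olean lag).

Context (cell «pub-residmod», rung 23a OBJECT→THEOREM chain, `CHAIN.md` «what stays outside Lean»).  The
instrument `res23.py` computes, for a monic cubic `S̃(Y) = Y³ − A1·Y² + A2·Y − A3` over a commutative ring `R`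
(in the instrument `R = ℤ[x]`) and an element `u = u0 + u1·Y + u2·Y²` of `R[Y]/(S̃)`, the norm of `u` as the
determinant of the multiplication-by-`u` matrix in the basis `1, Y, Y²` (`norm_cubic`, l.71–87: column `j` =
coordinates of `u·Y^j` after the reduction `Y³ ↦ A1·Y² − A2·Y + A3`), having first reduced a general
`G ∈ R[Y]` modulo `S̃` (`reduce_mod_S`, l.62–70).  This file types both steps as theorems about Mathlib's basis-free
`Algebra.norm` on `AdjoinRoot S̃ = R[Y]/(S̃)`:
* `norm_adjoinRoot_cubic_eq_det` (N3) — `Algebra.norm R (mk S̃ u)` IS the script's explicit 3×3 determinant;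
* `norm_adjoinRoot_mk_modByMonic` (N3′) — the norm of `mk T G` only depends on `G %ₘ T` (`T` monic).
After this (with the accepted `IntegerCertificate.lean` / `NormCertificate.lean`) the instrument's per-member norm
`R_inst` is a closed-form integer polynomial identity in Lean; only the script's loops/IO remain outside Lean.
Registered on the cell bus as R329 (2026-08-23) BEFORE proof; statements character-for-character as registered.

Main results (all PROVED, axioms `propext`, `Classical.choice`, `Quot.sound` only):
* `norm_adjoinRoot_mk_modByMonic`, `norm_adjoinRoot_cubic_eq_det`;
* sanity `example`: `T = Y³ − 2`, `u = Y` ⇒ matrix `[[0,0,2],[1,0,0],[0,1,0]]`, `det = 2 = N(∛2)`.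
-/

open Polynomial

namespace Summit.Ventures.ResidMod.Conjectures

section NormCubicFormula

/-- **(N3′) `reduce_mod_S`.**  For `T` monic, the norm of the class of `G` in `R[Y]/(T)` equals the norm of the
class of its remainder `G %ₘ T` (the two classes coincide: `AdjoinRoot.mk T` kills multiples of `T`).
[elementary commutative algebra; res23.py l.62–70] -/
theorem norm_adjoinRoot_mk_modByMonic {R : Type*} [CommRing R] {T : R[X]} (hT : T.Monic) (G : R[X]) :
    Algebra.norm R (AdjoinRoot.mk T G) = Algebra.norm R (AdjoinRoot.mk T (G %ₘ T)) := by
  have h : AdjoinRoot.mk T (G %ₘ T) = AdjoinRoot.mk T G := by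
    have := AdjoinRoot.mk_leftInverse hT (AdjoinRoot.mk T G)
    rwa [AdjoinRoot.modByMonicHom_mk] at this
  rw [h]

/-- **(N3) `norm_cubic`.**  For `S̃ = Y³ − A1·Y² + A2·Y − A3` (monic) and `u = u0 + u1·Y + u2·Y²`, Mathlib's
basis-free `Algebra.norm R` of the class of `u` in `R[Y]/(S̃)` is the determinant of the explicit matrix whose
column `j` holds the coordinates of `u·Y^j` in the basis `1, Y, Y²` after `Y³ ↦ A1·Y² − A2·Y + A3` —
verbatim the matrix of res23.py `norm_cubic(u, A1, A2, A3)` (`M[row][col]`).  Proof: power basis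
`AdjoinRoot.powerBasisAux'`, `Algebra.norm_eq_matrix_det`, entries `((u·Y^j) %ₘ S̃).coeff i` computed by
`div_modByMonic_unique` with the explicit quotients `0`, `C u2`, `C u2 * X + C (u1 + u2 * A1)`.
[elementary commutative algebra; res23.py l.71–87] -/
theorem norm_adjoinRoot_cubic_eq_det {R : Type*} [CommRing R] (A1 A2 A3 u0 u1 u2 : R) :
    Algebra.norm R (AdjoinRoot.mk (X ^ 3 - C A1 * X ^ 2 + C A2 * X - C A3) (C u0 + C u1 * X + C u2 * X ^ 2)) =
      Matrix.det !![u0, u2 * A3, (u1 + u2 * A1) * A3;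
                   u1, u0 - u2 * A2, u2 * A3 - (u1 + u2 * A1) * A2;
                   u2, u1 + u2 * A1, (u0 - u2 * A2) + (u1 + u2 * A1) * A1] := by
  classical
  nontriviality R
  set T : R[X] := X ^ 3 - C A1 * X ^ 2 + C A2 * X - C A3 with hTdef
  set G : R[X] := C u0 + C u1 * X + C u2 * X ^ 2 with hGdef
  have hT : T.Monic := by
    rw [hTdef]; monicity!
  have hTnat : T.natDegree = 3 := by
    rw [hTdef]; compute_degree!
  have hTdeg : T.degree = 3 := by
    rw [degree_eq_natDegree hT.ne_zero, hTnat]; rfl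
  -- coefficients and degree of a polynomial written as `C a + C b * X + C c * X ^ 2`
  have hcq : ∀ a b c : R, (C a + C b * X + C c * X ^ 2).coeff 0 = a ∧
      (C a + C b * X + C c * X ^ 2).coeff 1 = b ∧ (C a + C b * X + C c * X ^ 2).coeff 2 = c := by
    intro a b c
    refine ⟨?_, ?_, ?_⟩ <;> simp [coeff_X, coeff_C, coeff_X_pow]
  have hlt : ∀ a b c : R, (C a + C b * X + C c * X ^ 2).degree < T.degree := by
    intro a b c
    rw [hTdeg]
    exact lt_of_le_of_lt (b := (2 : WithBot ℕ)) (by compute_degree)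
      (by exact_mod_cast (by norm_num : (2 : ℕ) < 3))
  -- the three remainders `(G * X ^ j) %ₘ T`, `j = 0, 1, 2` (explicit quotients `0`, `C u2`, `C u2 * X + C _`)
  have hr0 : G %ₘ T = C u0 + C u1 * X + C u2 * X ^ 2 := by
    refine (div_modByMonic_unique (0 : R[X]) _ hT ⟨?_, hlt _ _ _⟩).2
    rw [hTdef, hGdef]; ring
  have hr1 : (G * X) %ₘ T = C (u2 * A3) + C (u0 - u2 * A2) * X + C (u1 + u2 * A1) * X ^ 2 := by
    refine (div_modByMonic_unique (C u2) _ hT ⟨?_, hlt _ _ _⟩).2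
    rw [hTdef, hGdef]; simp only [map_add, map_sub, map_mul]; ring
  have hr2 : (G * X ^ 2) %ₘ T = C ((u1 + u2 * A1) * A3) + C (u2 * A3 - (u1 + u2 * A1) * A2) * X
      + C ((u0 - u2 * A2) + (u1 + u2 * A1) * A1) * X ^ 2 := by
    refine (div_modByMonic_unique (C u2 * X + C (u1 + u2 * A1)) _ hT ⟨?_, hlt _ _ _⟩).2
    rw [hTdef, hGdef]; simp only [map_add, map_sub, map_mul]; ring
  -- the power basis `1, Y, Y²` and the entries of the multiplication matrix
  set b := AdjoinRoot.powerBasisAux' hT with hb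
  have hent : ∀ i j : Fin T.natDegree,
      Algebra.leftMulMatrix b (AdjoinRoot.mk T G) i j = ((G * X ^ (j : ℕ)) %ₘ T).coeff i := by
    intro i j
    rw [Algebra.leftMulMatrix_eq_repr_mul]
    have hbj : b j = AdjoinRoot.root T ^ (j : ℕ) := by
      rw [hb]; exact (AdjoinRoot.powerBasis' hT).basis_eq_pow j
    have e1 : AdjoinRoot.mk T G * AdjoinRoot.root T ^ (j : ℕ) = AdjoinRoot.mk T (G * X ^ (j : ℕ)) := by
      rw [map_mul, map_pow, AdjoinRoot.mk_X]
    rw [hbj, e1, hb, AdjoinRoot.powerBasisAux'_repr_apply_to_fun, AdjoinRoot.modByMonicHom_mk]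
  set e : Fin 3 ≃ Fin T.natDegree := finCongr hTnat.symm with he
  have hmat : (Algebra.leftMulMatrix b (AdjoinRoot.mk T G)).submatrix e e =
      !![u0, u2 * A3, (u1 + u2 * A1) * A3;
         u1, u0 - u2 * A2, u2 * A3 - (u1 + u2 * A1) * A2;
         u2, u1 + u2 * A1, (u0 - u2 * A2) + (u1 + u2 * A1) * A1] := by
    ext i j
    rw [Matrix.submatrix_apply, hent]
    fin_cases i <;> fin_cases j <;>
      simp only [he, finCongr_apply_coe, pow_zero, pow_one, mul_one, hr0, hr1, hr2] <;>
      first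
        | exact (hcq _ _ _).1
        | exact (hcq _ _ _).2.1
        | exact (hcq _ _ _).2.2
  rw [Algebra.norm_eq_matrix_det b, ← Matrix.det_submatrix_equiv_self e, hmat]

/-- Sanity value registered with R329: `T = Y³ − 2` (`A1 = A2 = 0`, `A3 = 2`), `u = Y` (`u0 = u2 = 0`, `u1 = 1`):
the matrix is `[[0,0,2],[1,0,0],[0,1,0]]` and the norm is `2 = N(∛2)`. -/
example : Algebra.norm ℤ (AdjoinRoot.mk (X ^ 3 - C (0 : ℤ) * X ^ 2 + C (0 : ℤ) * X - C (2 : ℤ))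
    (C (0 : ℤ) + C (1 : ℤ) * X + C (0 : ℤ) * X ^ 2)) = 2 := by
  rw [norm_adjoinRoot_cubic_eq_det]
  simp [Matrix.det_fin_three]

/-- The sanity matrix itself: the registered entries at `A1 = A2 = 0`, `A3 = 2`, `u0 = u2 = 0`, `u1 = 1`
evaluate to `[[0,0,2],[1,0,0],[0,1,0]]` (res23.py `norm_cubic([0,1,0], 0, 0, 2)` columns), determinant `2`. -/
example : !![(0 : ℤ), 0 * 2, (1 + 0 * 0) * 2;
             1, 0 - 0 * 2, 0 * 2 - (1 + 0 * 0) * 0;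
             0, 1 + 0 * 0, (0 - 0 * 0) + (1 + 0 * 0) * 0] = !![0, 0, 2; 1, 0, 0; 0, 1, 0] ∧
    Matrix.det !![(0 : ℤ), 0, 2; 1, 0, 0; 0, 1, 0] = 2 := by
  constructor
  · norm_num
  · simp [Matrix.det_fin_three]

end NormCubicFormula

end Summit.Ventures.ResidMod.Conjectures
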